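import Literature.Probability.RandomMatrixProducts.AndersonModel1DSmoothing
import Mathlib.MeasureTheory.Measure.ProbabilityMeasure
import Mathlib.Analysis.Normed.Lp.MeasurableSpace
import Mathlib.Topology.MetricSpace.ProperSpace
import HarnessLib

/-!
# The projective dynamics of the Anderson transfer matrices on the unit circle: normalised action, Markov operator, laws of directions, stationary measures

Companion to `AndersonModel1D.lean` (Bucaj–Damanik–Fillman–Gerbuz–VandenBoom–Wang–Zhang, TAMS **372**
(2019), arXiv:1706.06135, §§2–3) and the second of the files discharging the named fact
`BucajEtAl2019_vectorLDT` (Prop. 3.6 there).  This file only DEFINES the objects of the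
Fürstenberg-type analysis of the i.i.d. product `M_n^E = M^E(ω_{n-1}) ⋯ M^E(ω_0)` through its action
on directions, and proves their basic API; the analysis (non-atomicity of stationary measures,
`ν(ψ_E) = L(E)` for every stationary `ν`, uniform convergence of `n⁻¹ 𝔼 log ‖M_n^E v‖`) is in the
sequel files.

We work on the unit circle `𝕊 = {v ∈ ℝ² : ‖v‖ = 1}` (a compact metric space, the double cover of
the projective line `ℝℙ¹` of the source, §2) rather than on `ℝℙ¹`; nothing in the arguments needs
the identification `v ∼ -v`.

* `projAct M v = M v / ‖M v‖` — the action of an invertible `2 × 2` matrix on `𝕊` (junk value `v`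
  when `M v = 0`, which never happens for `det M ≠ 0`); `projAct (A * B) = projAct A ∘ projAct B`.
* `circlePsi μ E v = ∫ log ‖M^E(a) v‖ dμ(a)` — the averaged one-step cocycle `ψ_E`, whose integral
  against a stationary measure is the Lyapunov exponent (Fürstenberg's formula, proved in the sequel).
* `circleMarkov μ E f v = ∫ f (M^E(a) · v) dμ(a)` — the Markov (transition) operator of the
  direction chain `v_k = M_k^E w / ‖M_k^E w‖`.
* `dirVec E n w x = M_n^E(x) · w`, `dirLaw μ E n w` = its law under `μ^{⊗n}` (a probability measure
  on `𝕊`), `cesaroLaw μ E n w = (n+1)⁻¹ Σ_{k ≤ n} dirLaw μ E k w` (Krylov–Bogolyubov averages).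
* `IsStationaryFor μ E ν` — `ν` is `μ`-stationary for the action at energy `E`:
  `∫ (M^E(a) ·)_* ν dμ(a) = ν`, written as `map (a, v) ↦ M^E(a)·v (μ ⊗ ν) = ν`.

References: H. Furstenberg, *Noncommuting random products*, Trans. AMS **108** (1963) 377–428, §§1–3;
P. Bougerol, J. Lacroix, *Products of Random Matrices with Applications to Schrödinger Operators*,
Birkhäuser 1985, Part A, Ch. II §§1–4 (stationary measures on the projective space); Bucaj et al., §2.
-/

noncomputable section

open MeasureTheory Set Filter
open scoped Matrix.Norms.L2Operator ENNReal Topology Matrix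

namespace Literature.Probability.RandomMatrixProducts

/-- The unit circle of `ℝ²` (local notation for Mathlib's `Metric.sphere 0 1`). -/
local notation "𝕊" => Metric.sphere (0 : EuclideanSpace ℝ (Fin 2)) 1

/-! ### Invertible `2 × 2` matrices do not annihilate non-zero vectors -/

/-- If `det M ≠ 0` and `v ≠ 0` then `M v ≠ 0`. [folklore] -/
theorem toEuclideanLin_apply_ne_zero {M : Matrix (Fin 2) (Fin 2) ℝ} (hM : M.det ≠ 0)
    {v : EuclideanSpace ℝ (Fin 2)} (hv : v ≠ 0) : Matrix.toEuclideanLin M v ≠ 0 := by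
  intro h
  apply hv
  have h1 : M *ᵥ (WithLp.ofLp (v : EuclideanSpace ℝ (Fin 2))) = 0 := congrArg WithLp.ofLp h
  have h2 : WithLp.ofLp v = 0 := Matrix.eq_zero_of_mulVec_eq_zero hM h1
  have h3 : v = WithLp.toLp 2 (WithLp.ofLp v) := rfl
  rw [h3, h2, WithLp.toLp_zero]

/-- A point of the unit circle, as a vector, has norm `1`. [folklore] -/
theorem norm_coe_circle (v : 𝕊) : ‖(v : EuclideanSpace ℝ (Fin 2))‖ = 1 := norm_eq_of_mem_sphere v

/-- A point of the unit circle, as a vector, is non-zero. [folklore] -/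
theorem coe_circle_ne_zero (v : 𝕊) : (v : EuclideanSpace ℝ (Fin 2)) ≠ 0 := ne_zero_of_mem_unit_sphere v

/-! ### The projective action on the circle -/

/-- The normalisation `u/‖u‖` of a non-zero vector lies on the unit circle. [folklore] -/
theorem normalize_mem_circle {u : EuclideanSpace ℝ (Fin 2)} (hu : u ≠ 0) : (‖u‖)⁻¹ • u ∈ 𝕊 := by
  rw [mem_sphere_zero_iff_norm, norm_smul, norm_inv, norm_norm, inv_mul_cancel₀ (norm_ne_zero_iff.mpr hu)]

/-- **The action of a `2 × 2` matrix on the unit circle**, `v ↦ M v / ‖M v‖` (with the junk value `v`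
when `M v = 0`, which does not occur for invertible `M`). On `𝕊` (rather than `ℝℙ¹`) the matrix `-1`
acts as the antipodal map. [cite: BucajEtAl2019, §2 (the induced map on `ℝℙ¹`)] -/
def projAct (M : Matrix (Fin 2) (Fin 2) ℝ) (v : 𝕊) : 𝕊 :=
  if h : Matrix.toEuclideanLin M v = 0 then v else
    ⟨(‖Matrix.toEuclideanLin M v‖)⁻¹ • Matrix.toEuclideanLin M v, normalize_mem_circle h⟩

/-- The defining formula `projAct M v = M v / ‖M v‖` whenever `M v ≠ 0`. [folklore] -/
theorem coe_projAct {M : Matrix (Fin 2) (Fin 2) ℝ} {v : 𝕊} (h : Matrix.toEuclideanLin M v ≠ 0) :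
    (projAct M v : EuclideanSpace ℝ (Fin 2)) =
      (‖Matrix.toEuclideanLin M v‖)⁻¹ • Matrix.toEuclideanLin M v := by
  rw [projAct, dif_neg h]

/-- The defining formula for invertible `M`. [folklore] -/
theorem coe_projAct_of_det {M : Matrix (Fin 2) (Fin 2) ℝ} (hM : M.det ≠ 0) (v : 𝕊) :
    (projAct M v : EuclideanSpace ℝ (Fin 2)) =
      (‖Matrix.toEuclideanLin M v‖)⁻¹ • Matrix.toEuclideanLin M v :=
  coe_projAct (toEuclideanLin_apply_ne_zero hM (coe_circle_ne_zero v))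

/-- `M v = ‖M v‖ • (M · v)`: the image vector is a positive multiple of the image direction. [folklore] -/
theorem toEuclideanLin_apply_eq_norm_smul_projAct {M : Matrix (Fin 2) (Fin 2) ℝ} {v : 𝕊}
    (h : Matrix.toEuclideanLin M v ≠ 0) :
    Matrix.toEuclideanLin M v = ‖Matrix.toEuclideanLin M v‖ • (projAct M v : EuclideanSpace ℝ (Fin 2)) := by
  rw [coe_projAct h, smul_smul, mul_inv_cancel₀ (norm_ne_zero_iff.mpr h), one_smul]

/-- The action does not see positive scalars: `M · (c v/‖c v‖) = M · v̂`; concretely, for `u ≠ 0` with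
`M u ≠ 0`, the direction of `M u` is `projAct M` of the direction of `u`. [folklore] -/
theorem projAct_dir {M : Matrix (Fin 2) (Fin 2) ℝ} {u : EuclideanSpace ℝ (Fin 2)} (hu : u ≠ 0)
    (hMu : Matrix.toEuclideanLin M u ≠ 0) :
    (projAct M ⟨(‖u‖)⁻¹ • u, normalize_mem_circle hu⟩ : EuclideanSpace ℝ (Fin 2)) =
      (‖Matrix.toEuclideanLin M u‖)⁻¹ • Matrix.toEuclideanLin M u := by
  have hupos : 0 < ‖u‖ := norm_pos_iff.mpr hu
  have hsm : Matrix.toEuclideanLin M ((‖u‖)⁻¹ • u) = (‖u‖)⁻¹ • Matrix.toEuclideanLin M u :=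
    LinearMap.map_smul _ _ _
  have hne : Matrix.toEuclideanLin M ((‖u‖)⁻¹ • u) ≠ 0 := by
    rw [hsm]; exact smul_ne_zero (inv_ne_zero hupos.ne') hMu
  have h1 : (projAct M ⟨(‖u‖)⁻¹ • u, normalize_mem_circle hu⟩ : EuclideanSpace ℝ (Fin 2)) =
      (‖Matrix.toEuclideanLin M ((‖u‖)⁻¹ • u)‖)⁻¹ • Matrix.toEuclideanLin M ((‖u‖)⁻¹ • u) := coe_projAct hne
  rw [h1, hsm, norm_smul, norm_inv, norm_norm, smul_smul]
  congr 1
  field_simp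

/-- **The action is multiplicative**: `(A B) · v = A · (B · v)` for invertible `A, B`. [folklore] -/
theorem projAct_mul {A B : Matrix (Fin 2) (Fin 2) ℝ} (hA : A.det ≠ 0) (hB : B.det ≠ 0) (v : 𝕊) :
    projAct (A * B) v = projAct A (projAct B v) := by
  apply Subtype.ext
  have hBv : Matrix.toEuclideanLin B v ≠ 0 := toEuclideanLin_apply_ne_zero hB (coe_circle_ne_zero v)
  have hABv : Matrix.toEuclideanLin A (Matrix.toEuclideanLin B v) ≠ 0 := toEuclideanLin_apply_ne_zero hA hBv
  have hAB : (A * B).det ≠ 0 := by rw [Matrix.det_mul]; exact mul_ne_zero hA hB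
  rw [coe_projAct_of_det hAB]
  have h1 : projAct B v = ⟨(‖Matrix.toEuclideanLin B v‖)⁻¹ • Matrix.toEuclideanLin B v, normalize_mem_circle hBv⟩ :=
    Subtype.ext (coe_projAct hBv)
  rw [h1, projAct_dir hBv hABv]
  simp only [toEuclideanLin_mul_apply]

/-- The identity matrix acts trivially. [folklore] -/
theorem projAct_one (v : 𝕊) : projAct 1 v = v := by
  apply Subtype.ext
  rw [coe_projAct_of_det (by simp) v]
  simp [norm_coe_circle v]

/-- `M⁻¹ · (M · v) = v` for invertible `M`. [folklore] -/
theorem projAct_inv_mul_cancel {M : Matrix (Fin 2) (Fin 2) ℝ} (hM : M.det ≠ 0) (v : 𝕊) :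
    projAct M⁻¹ (projAct M v) = v := by
  have hunit : IsUnit M.det := isUnit_iff_ne_zero.mpr hM
  have hMinv : M⁻¹.det ≠ 0 := (M.isUnit_nonsing_inv_det hunit).ne_zero
  rw [← projAct_mul hMinv hM, Matrix.nonsing_inv_mul M hunit, projAct_one]

/-- `M · (M⁻¹ · v) = v` for invertible `M`. [folklore] -/
theorem projAct_mul_inv_cancel {M : Matrix (Fin 2) (Fin 2) ℝ} (hM : M.det ≠ 0) (v : 𝕊) :
    projAct M (projAct M⁻¹ v) = v := by
  have hunit : IsUnit M.det := isUnit_iff_ne_zero.mpr hM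
  have hMinv : M⁻¹.det ≠ 0 := (M.isUnit_nonsing_inv_det hunit).ne_zero
  rw [← projAct_mul hM hMinv, Matrix.mul_nonsing_inv M hunit, projAct_one]

/-- The action of an invertible matrix is injective. [folklore] -/
theorem projAct_injective {M : Matrix (Fin 2) (Fin 2) ℝ} (hM : M.det ≠ 0) : Function.Injective (projAct M) :=
  fun v w h => by rw [← projAct_inv_mul_cancel hM v, h, projAct_inv_mul_cancel hM w]

/-- The preimage of a point under the action of an invertible `M` is the point `M⁻¹ · p`. [folklore] -/
theorem projAct_preimage_singleton {M : Matrix (Fin 2) (Fin 2) ℝ} (hM : M.det ≠ 0) (p : 𝕊) :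
    projAct M ⁻¹' {p} = {projAct M⁻¹ p} := by
  ext v
  simp only [Set.mem_preimage, Set.mem_singleton_iff]
  constructor
  · intro h; rw [← h, projAct_inv_mul_cancel hM]
  · intro h; rw [h, projAct_mul_inv_cancel hM]

/-! ### Continuity of the action -/

/-- The normalisation map `u ↦ u/‖u‖` is continuous away from `0`. [folklore] -/
theorem continuousOn_normalize :
    ContinuousOn (fun u : EuclideanSpace ℝ (Fin 2) => (‖u‖)⁻¹ • u) {u | u ≠ 0} :=
  (continuousOn_id.norm.inv₀ fun _ hu => norm_ne_zero_iff.mpr hu).smul continuousOn_id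

/-- **Joint continuity of the action**: if `M : X → Matrices` (through its image vectors) and
`v : X → 𝕊` are continuous and `M x (v x) ≠ 0` everywhere, then `x ↦ M x · v x` is continuous.
[folklore] -/
theorem continuous_projAct_of {X : Type*} [TopologicalSpace X] {M : X → Matrix (Fin 2) (Fin 2) ℝ}
    {v : X → 𝕊} (hMv : Continuous fun x => Matrix.toEuclideanLin (M x) (v x))
    (hne : ∀ x, Matrix.toEuclideanLin (M x) (v x) ≠ 0) :
    Continuous fun x => projAct (M x) (v x) := by
  have heq : (fun x => projAct (M x) (v x)) = fun x =>
      (⟨(‖Matrix.toEuclideanLin (M x) (v x)‖)⁻¹ • Matrix.toEuclideanLin (M x) (v x), normalize_mem_circle (hne x)⟩ : 𝕊) := by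
    funext x
    exact Subtype.ext (coe_projAct (hne x))
  rw [heq]
  refine Continuous.subtype_mk ?_ _
  exact (hMv.norm.inv₀ fun x => norm_ne_zero_iff.mpr (hne x)).smul hMv

/-- `(M, u) ↦ M u` is continuous (jointly in the matrix entries and the vector). [folklore] -/
theorem continuous_toEuclideanLin_apply {X : Type*} [TopologicalSpace X] {M : X → Matrix (Fin 2) (Fin 2) ℝ}
    {u : X → EuclideanSpace ℝ (Fin 2)} (hM : ∀ i j, Continuous fun x => M x i j) (hu : Continuous u) :
    Continuous fun x => Matrix.toEuclideanLin (M x) (u x) := by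
  have hu' : ∀ j, Continuous fun x => u x j := fun j =>
    (continuous_apply j).comp ((PiLp.continuous_ofLp 2 _).comp hu)
  have : (fun x => Matrix.toEuclideanLin (M x) (u x)) =
      fun x => WithLp.toLp 2 fun i => M x i 0 * u x 0 + M x i 1 * u x 1 := by
    funext x
    apply PiLp.ext
    intro i
    rw [toEuclideanLin_apply_two]
  rw [this]
  refine (PiLp.continuous_toLp 2 _).comp (continuous_pi fun i => ?_)
  fun_prop

/-- **Continuity of the one-step action in energy, potential and direction**:
`(E, a, v) ↦ M^E(a) · v` is continuous. [folklore] -/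
theorem continuous_projAct_andersonTransfer :
    Continuous fun p : ℝ × ℝ × 𝕊 => projAct (andersonTransfer p.1 p.2.1) p.2.2 := by
  refine continuous_projAct_of ?_ fun p => toEuclideanLin_apply_ne_zero (by simp) (coe_circle_ne_zero _)
  refine continuous_toEuclideanLin_apply (fun i j => ?_) (continuous_subtype_val.comp (continuous_snd.comp continuous_snd))
  fin_cases i <;> fin_cases j <;> simp [andersonTransfer] <;> fun_prop

/-- For fixed energy and potential, `v ↦ M^E(a) · v` is continuous. [folklore] -/
theorem continuous_projAct_andersonTransfer_right (E a : ℝ) :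
    Continuous fun v : 𝕊 => projAct (andersonTransfer E a) v :=
  continuous_projAct_of (M := fun _ => andersonTransfer E a)
    (continuous_toEuclideanLin_apply (fun _ _ => continuous_const) continuous_subtype_val)
    fun v => toEuclideanLin_apply_ne_zero (by simp) (coe_circle_ne_zero v)

/-- For a fixed direction, `a ↦ M^E(a) · v` is continuous. [folklore] -/
theorem continuous_projAct_andersonTransfer_left (E : ℝ) (v : 𝕊) :
    Continuous fun a : ℝ => projAct (andersonTransfer E a) v := by
  refine continuous_projAct_of (v := fun _ => v) ?_ fun a => toEuclideanLin_apply_ne_zero (by simp) (coe_circle_ne_zero v)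
  refine continuous_toEuclideanLin_apply (fun i j => ?_) continuous_const
  fin_cases i <;> fin_cases j <;> simp [andersonTransfer] <;> fun_prop

/-- `(a, v) ↦ M^E(a) · v` is measurable. [folklore] -/
theorem measurable_projAct_andersonTransfer (E : ℝ) :
    Measurable fun p : ℝ × 𝕊 => projAct (andersonTransfer E p.1) p.2 :=
  (continuous_projAct_andersonTransfer.comp (Continuous.prodMk continuous_const continuous_id)).measurable

/-! ### The one-step cocycle and its average `ψ_E` -/

/-- **The averaged one-step expansion rate** `ψ_E(v) = ∫ log ‖M^E(a) v‖ dμ(a)` of the direction `v`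
(the function whose `ν`-average is `L(E)` for a stationary `ν`, Fürstenberg's formula).
[cite: BucajEtAl2019, §2 (the cocycle `(T, M^E)`)] -/
def circlePsi (μ : Measure ℝ) (E : ℝ) (v : 𝕊) : ℝ :=
  ∫ a, Real.log ‖Matrix.toEuclideanLin (andersonTransfer E a) v‖ ∂μ

/-! ### The Markov operator of the direction chain -/

/-- **The Markov operator** `(Q_E f)(v) = ∫ f(M^E(a) · v) dμ(a)` of the chain of directions
`v_{k+1} = M^E(ω_k) · v_k`. [cite: BucajEtAl2019, §3 (proof of Prop. 3.6: the vectors `v_p`)] -/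
def circleMarkov (μ : Measure ℝ) (E : ℝ) (f : 𝕊 → ℝ) (v : 𝕊) : ℝ :=
  ∫ a, f (projAct (andersonTransfer E a) v) ∂μ

/-! ### Directions after `n` steps and their laws -/

/-- **The direction after `n` steps**: `v_n = M_n^E(x) · w` for a finite sample `x : Fin n → ℝ`.
[cite: BucajEtAl2019, §3 (proof of Prop. 3.6: the vectors `v_p`)] -/
def dirVec (E : ℝ) (n : ℕ) (w : 𝕊) (x : Fin n → ℝ) : 𝕊 := projAct (andersonTransferProd E (padSeq x) n) w

/-- `det M_n = 1 ≠ 0`. [folklore] -/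
theorem det_andersonTransferProd_ne_zero (E : ℝ) (α : ℕ → ℝ) (n : ℕ) : (andersonTransferProd E α n).det ≠ 0 := by
  rw [det_andersonTransferProd]; exact one_ne_zero

/-- The defining formula `v_n = M_n w / ‖M_n w‖`. [folklore] -/
theorem coe_dirVec (E : ℝ) (n : ℕ) (w : 𝕊) (x : Fin n → ℝ) :
    (dirVec E n w x : EuclideanSpace ℝ (Fin 2)) =
      (‖Matrix.toEuclideanLin (andersonTransferProd E (padSeq x) n) w‖)⁻¹ •
        Matrix.toEuclideanLin (andersonTransferProd E (padSeq x) n) w :=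
  coe_projAct_of_det (det_andersonTransferProd_ne_zero E _ n) w

/-- At time `0` the direction is the starting direction. [folklore] -/
theorem dirVec_zero (E : ℝ) (w : 𝕊) (x : Fin 0 → ℝ) : dirVec E 0 w x = w := by
  unfold dirVec
  rw [andersonTransferProd_zero, projAct_one]

/-- `x ↦ v_n(x)` is continuous. [folklore] -/
theorem continuous_dirVec (E : ℝ) (n : ℕ) (w : 𝕊) : Continuous (dirVec E n w) :=
  continuous_projAct_of (continuous_andersonTransferProd_apply E n (w : EuclideanSpace ℝ (Fin 2)))
    fun _ => toEuclideanLin_apply_ne_zero (det_andersonTransferProd_ne_zero E _ n) (coe_circle_ne_zero w)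

/-- `x ↦ v_n(x)` is measurable. [folklore] -/
theorem measurable_dirVec (E : ℝ) (n : ℕ) (w : 𝕊) : Measurable (dirVec E n w) :=
  (continuous_dirVec E n w).measurable

/-- **The cocycle over an appended sample, for directions**: `v_{n+m}(x ⧺ y) = M_m(y) · v_n(x)`.
[cite: BucajEtAl2019, §3 (proof of Prop. 3.6, the cocycle identity)] -/
theorem dirVec_append (E : ℝ) {n m : ℕ} (w : 𝕊) (x : Fin n → ℝ) (y : Fin m → ℝ) :
    dirVec E (n + m) w (Fin.append x y) = projAct (andersonTransferProd E (padSeq y) m) (dirVec E n w x) := by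
  unfold dirVec
  rw [andersonTransferProd_append, projAct_mul (det_andersonTransferProd_ne_zero E _ m)
    (det_andersonTransferProd_ne_zero E _ n)]

/-- One more step: `v_{n+1}(x ⧺ (a)) = M^E(a) · v_n(x)`. [cite: BucajEtAl2019, §3 (proof of Prop. 3.6)] -/
theorem dirVec_append_one (E : ℝ) {n : ℕ} (w : 𝕊) (x : Fin n → ℝ) (a : ℝ) :
    dirVec E (n + 1) w (Fin.append x (fun _ : Fin 1 => a)) = projAct (andersonTransfer E a) (dirVec E n w x) := by
  rw [dirVec_append]
  congr 1
  show andersonTransfer E (padSeq (fun _ : Fin 1 => a) 0) * 1 = andersonTransfer E a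
  rw [padSeq_of_lt _ Nat.zero_lt_one, mul_one]

/-- **The law of the direction after `n` steps** started at `w`: the image of `μ^{⊗n}` under `x ↦ v_n(x)`.
[cite: BucajEtAl2019, §3 (proof of Prop. 3.6)] -/
def dirLaw (μ : Measure ℝ) (E : ℝ) (n : ℕ) (w : 𝕊) : Measure 𝕊 :=
  (Measure.pi fun _ : Fin n => μ).map (dirVec E n w)

/-- `dirLaw` is a probability measure. [folklore] -/
instance isProbabilityMeasure_dirLaw (μ : Measure ℝ) [IsProbabilityMeasure μ] (E : ℝ) (n : ℕ) (w : 𝕊) :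
    IsProbabilityMeasure (dirLaw μ E n w) :=
  Measure.isProbabilityMeasure_map (measurable_dirVec E n w).aemeasurable

/-- Integration against `dirLaw` is integration over the sample. [folklore] -/
theorem integral_dirLaw (μ : Measure ℝ) (E : ℝ) (n : ℕ) (w : 𝕊) {f : 𝕊 → ℝ}
    (hf : AEStronglyMeasurable f (dirLaw μ E n w)) :
    ∫ v, f v ∂(dirLaw μ E n w) = ∫ x, f (dirVec E n w x) ∂(Measure.pi fun _ : Fin n => μ) :=
  integral_map (measurable_dirVec E n w).aemeasurable hf

/-- At time `0` the law is the Dirac mass at the starting direction. [folklore] -/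
theorem dirLaw_zero (μ : Measure ℝ) [IsProbabilityMeasure μ] (E : ℝ) (w : 𝕊) :
    dirLaw μ E 0 w = Measure.dirac w := by
  unfold dirLaw
  have : dirVec E 0 w = fun _ => w := funext fun x => dirVec_zero E w x
  rw [this, Measure.map_const, measure_univ, one_smul]

/-- **Cesàro (Krylov–Bogolyubov) averages** of the laws of directions: `(n+1)⁻¹ Σ_{k ≤ n} dirLaw μ E k w`.
[folklore] -/
def cesaroLaw (μ : Measure ℝ) (E : ℝ) (n : ℕ) (w : 𝕊) : Measure 𝕊 :=
  ((n : ℝ≥0∞) + 1)⁻¹ • ∑ k ∈ Finset.range (n + 1), dirLaw μ E k w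

/-- The Cesàro average is a probability measure. [folklore] -/
instance isProbabilityMeasure_cesaroLaw (μ : Measure ℝ) [IsProbabilityMeasure μ] (E : ℝ) (n : ℕ) (w : 𝕊) :
    IsProbabilityMeasure (cesaroLaw μ E n w) := by
  constructor
  simp only [cesaroLaw, Measure.smul_apply, Measure.coe_finsetSum, Finset.sum_apply]
  simp only [measure_univ, Finset.sum_const, Finset.card_range, nsmul_eq_mul, mul_one, smul_eq_mul]
  push_cast
  exact ENNReal.inv_mul_cancel (by positivity) (by simp)

/-- Integration against the Cesàro average. [folklore] -/
theorem integral_cesaroLaw (μ : Measure ℝ) [IsProbabilityMeasure μ] (E : ℝ) (n : ℕ) (w : 𝕊) {f : 𝕊 → ℝ}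
    (hf : ∀ k, Integrable f (dirLaw μ E k w)) :
    ∫ v, f v ∂(cesaroLaw μ E n w) = ((n : ℝ) + 1)⁻¹ * ∑ k ∈ Finset.range (n + 1), ∫ v, f v ∂(dirLaw μ E k w) := by
  simp only [cesaroLaw]
  rw [integral_smul_measure, integral_finsetSum_measure fun k _ => hf k, smul_eq_mul]
  congr 1
  rw [ENNReal.toReal_inv, ENNReal.toReal_add (by simp) ENNReal.one_ne_top, ENNReal.toReal_natCast,
    ENNReal.toReal_one]

/-! ### Stationary measures -/

/-- **`μ`-stationary probability measures for the action at energy `E`**: `ν` on `𝕊` with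
`∫ (M^E(a) ·)_* ν dμ(a) = ν`, i.e. the image of `μ ⊗ ν` under `(a, v) ↦ M^E(a) · v` is `ν` (the law of
the chain of directions started from `ν` is constant). [cite: BucajEtAl2019, §2 (Fürstenberg's theorem; `ν_E`)] -/
def IsStationaryFor (μ : Measure ℝ) (E : ℝ) (ν : Measure 𝕊) : Prop :=
  (μ.prod ν).map (fun p : ℝ × 𝕊 => projAct (andersonTransfer E p.1) p.2) = ν

/-- **Stationarity in integrated form**: `∫∫ f(M^E(a) · v) dν(v) dμ(a) = ∫ f dν` for bounded measurable
`f`, i.e. `ν(Q_E f) = ν(f)` after Fubini. [cite: BucajEtAl2019, §2] -/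
theorem IsStationaryFor.integral_eq {μ : Measure ℝ} [IsProbabilityMeasure μ] {E : ℝ} {ν : Measure 𝕊}
    [IsProbabilityMeasure ν] (h : IsStationaryFor μ E ν) {f : 𝕊 → ℝ} (hf : Measurable f) {C : ℝ}
    (hC : ∀ v, |f v| ≤ C) :
    ∫ v, circleMarkov μ E f v ∂ν = ∫ v, f v ∂ν := by
  have hmeas := measurable_projAct_andersonTransfer E
  have hint : Integrable (fun p : ℝ × 𝕊 => f (projAct (andersonTransfer E p.1) p.2)) (μ.prod ν) := by
    refine Integrable.of_bound ((hf.comp hmeas).aestronglyMeasurable) C (Eventually.of_forall fun p => ?_)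
    rw [Real.norm_eq_abs]; exact hC _
  calc ∫ v, circleMarkov μ E f v ∂ν = ∫ v, ∫ a, f (projAct (andersonTransfer E a) v) ∂μ ∂ν := rfl
    _ = ∫ p, f (projAct (andersonTransfer E p.1) p.2) ∂(μ.prod ν) := (integral_prod_symm _ hint).symm
    _ = ∫ v, f v ∂((μ.prod ν).map fun p : ℝ × 𝕊 => projAct (andersonTransfer E p.1) p.2) :=
        (integral_map hmeas.aemeasurable hf.aestronglyMeasurable).symm
    _ = ∫ v, f v ∂ν := by rw [h]

/-- **Stationarity on sets**: `ν(B) = ∫ ν((M^E(a) ·)⁻¹ B) dμ(a)` for measurable `B`. [cite: BucajEtAl2019, §2] -/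
theorem IsStationaryFor.measure_eq {μ : Measure ℝ} [SFinite μ] {E : ℝ} {ν : Measure 𝕊} [SFinite ν]
    (h : IsStationaryFor μ E ν) {B : Set 𝕊} (hB : MeasurableSet B) :
    ν B = ∫⁻ a, ν ((fun v => projAct (andersonTransfer E a) v) ⁻¹' B) ∂μ := by
  have hmeas := measurable_projAct_andersonTransfer E
  conv_lhs => rw [← h]
  rw [Measure.map_apply hmeas hB, Measure.prod_apply (hmeas hB)]
  rfl

end Literature.Probability.RandomMatrixProducts

end
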